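import Summits.QuantumFields.YangMills.Theorems.LuscherReductionDressedRitzLiftPositionSlowStiff
import HarnessLib

/-!
# Crux `DressedRitz` (stmt-QuantumFields-20205), line «polyakovlift», stub S-POS `stub_liftPosition` — support IV:
# the COUPLING clause (o6) from the BILINEAR form split against an exact eigenfamily (slow levers × mixed weights + stiff remainders)

Support module (LEAD prover ym-lead-20205-polyakovlift g0; `--supports stmt-QuantumFields-20205`, helper, no closure claim), companion of support III
(`…LiftPositionSlowStiff.lean`: (o5) from an exact-level position + slow/stiff budget).  Here the POLARISED version: against a finite exact physical
`l2`-orthonormal eigenfamily `ψ_0 … ψ_{N−1}` (`K_βψ_j = λ_jψ_j`), for physical `u, v` with weights `a_j = ⟨u,ψ_j⟩`, `b_j = ⟨v,ψ_j⟩` and remainders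
`r_u, r_v ⊥ ψ`:

  `⟨u,v⟩ = Σ_j a_j b_j + ⟨r_u,r_v⟩`,   `⟨u,K_βv⟩ = Σ_j λ_j a_j b_j + ⟨r_u,K_βr_v⟩`      (`bilin_split_eigenfamily`),

hence for EVERY reference value `κ̄` (`coupling_defect_le`):

  `|⟨u,K_βv⟩ − κ̄⟨u,v⟩| ≤ Σ_j |λ_j − κ̄|·|a_j b_j| + (λ₀ + |κ̄|)·‖r_u‖‖r_v‖`

(Cauchy–Schwarz for the `K_β`-form, `⟨r,K_βr⟩ ≤ λ₀‖r‖²`).  With `κ̄ = ½(d_ii/n_ii + d_ll/n_ll)` this is the (o6) defect VERBATIM (`coreO6_of_slow_stiff`):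
the RG content of (o6) is «mixed slow weights `|a_j b_j| = O(λ)√n_i√n_l` at levers `|λ_j − κ̄| ≍ (λ/L)λ₀` + stiff remainders `‖r_i‖‖r_l‖ = O(λ²/L)√n_i√n_l`».
Together with supports I–III: the whole core stub S-POS ⇐ [RED-positions of the designated exact levels] ∧ [NEAR: `O(√λ)`∕`O(λ)` quasimode weights and
`O(λ²/L)` stiff weights of the explicit (dressed) insertions] — kernel-checked reductions; the bracketed inputs are the OPEN estimates.

* `bilin_split_abstract` ∕ `bilin_split_eigenfamily` — the polarised Pythagorean split (abstract (D, ip, K) ∕ the tree's physical subspace);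
* `coupling_defect_le`;  ★ `coreO6_of_slow_stiff` — (o6) conjunct of `PolyakovLift.DynamicCoreClauses`, VERBATIM.

HONEST FRAMING: fixed-lattice functional analysis on the conditional femto rung R2b1; the stub stays OPEN; nothing here bears on infinite volume, the
continuum limit or the Clay gap.  References: Reed–Simon IV, Thm XIII.1 [cite: ReedSimonIV1978, Thm XIII.1]; M. Lüscher, NPB 219 (1983) 233
[cite: Luscher1983, §3]; T. Kato, J. Phys. Soc. Japan 4 (1949) 334 [cite: Kato1949, §1].
-/

set_option autoImplicit false

noncomputable section

open MeasureTheory Filter Topology Real Finset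
open Literature.MathematicalPhysics.QuantumFieldTheory
open Literature.MathematicalPhysics.QuantumLattice
open Literature.Analysis.OperatorTheory
open scoped BigOperators

namespace Summit.QuantumFields.YangMills.Theorems.FemtoTransferGap.LiftPos

open Summit.QuantumFields.YangMills.Theorems.FemtoTransferGap
open Summit.QuantumFields.YangMills.Theorems.FemtoTransferGap.LiftLeak

/-! ## §1 The polarised form split (abstract) -/

section Abstract

variable {D : Type*} [AddCommGroup D] [Module ℝ D]

/-- **Polarised Pythagorean split** against `ip`-orthonormal exact eigenvectors of an `ip`-symmetric `K` (`ip` symmetric): with `a_j = ip(x,e_j)`,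
`b_j = ip(y,e_j)`, `r_x = x − Σa_je_j`, `r_y = y − Σb_je_j`: `ip(x,y) = Σ a_jb_j + ip(r_x,r_y)` and `ip(x,Ky) = Σ λ_ja_jb_j + ip(r_x,Kr_y)`. [cite: ReedSimonIV1978, Thm XIII.1] -/
theorem bilin_split_abstract (ip : D →ₗ[ℝ] D →ₗ[ℝ] ℝ) (hip : ∀ x y, ip x y = ip y x) (K : D →ₗ[ℝ] D)
    (hK : ∀ x y, ip (K x) y = ip x (K y)) {N : ℕ} (e : Fin N → D) (ev : Fin N → ℝ)
    (hon : ∀ i l, ip (e i) (e l) = if i = l then 1 else 0) (heig : ∀ j, K (e j) = ev j • e j) (x y : D) :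
    ip x y = ∑ j, ip x (e j) * ip y (e j) + ip (x - ∑ j, ip x (e j) • e j) (y - ∑ j, ip y (e j) • e j) ∧
      ip x (K y) = ∑ j, ev j * (ip x (e j) * ip y (e j)) +
        ip (x - ∑ j, ip x (e j) • e j) (K (y - ∑ j, ip y (e j) • e j)) := by
  classical
  set rx : D := x - ∑ j, ip x (e j) • e j with hrx_def
  set ry : D := y - ∑ j, ip y (e j) • e j with hry_def
  set px : D := ∑ j, ip x (e j) • e j with hpx_def
  set py : D := ∑ j, ip y (e j) • e j with hpy_def
  have hrx : ∀ l, ip rx (e l) = 0 := ip_remainder_eq_zero ip e hon x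
  have hry : ∀ l, ip ry (e l) = 0 := ip_remainder_eq_zero ip e hon y
  have hKry : ∀ l, ip (K ry) (e l) = 0 := ip_apply_eigen_eq_zero ip K hK e ev heig hry
  have hx : x = px + rx := by rw [hrx_def, hpx_def]; abel
  have hy : y = py + ry := by rw [hry_def, hpy_def]; abel
  have hpxry : ip px ry = 0 := by
    rw [hpx_def, bilin_sum_smul_left]
    exact sum_eq_zero fun j _ => by rw [hip (e j) ry, hry j, mul_zero]
  have hrxpy : ip rx py = 0 := by
    rw [hpy_def, bilin_sum_smul_right]
    exact sum_eq_zero fun j _ => by rw [hrx j, mul_zero]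
  have hpxpy : ip px py = ∑ j, ip x (e j) * ip y (e j) := by
    rw [hpx_def, hpy_def, bilin_sum_smul_sum_smul]
    refine sum_congr rfl fun j _ => ?_
    simp only [hon, mul_ite, mul_one, mul_zero, Finset.sum_ite_eq, Finset.mem_univ, if_true]
  have hKpy : K py = ∑ j, (ip y (e j) * ev j) • e j := by
    rw [hpy_def, map_sum]
    refine sum_congr rfl fun j _ => ?_
    rw [map_smul, heig, smul_smul]
  have hpxKpy : ip px (K py) = ∑ j, ev j * (ip x (e j) * ip y (e j)) := by
    rw [hKpy, hpx_def, bilin_sum_smul_sum_smul]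
    refine sum_congr rfl fun j _ => ?_
    simp only [hon, mul_ite, mul_one, mul_zero, Finset.sum_ite_eq, Finset.mem_univ, if_true]
    ring
  have hrxKpy : ip rx (K py) = 0 := by
    rw [hKpy, bilin_sum_smul_right]
    exact sum_eq_zero fun j _ => by rw [hrx j, mul_zero]
  have hpxKry : ip px (K ry) = 0 := by
    rw [hpx_def, bilin_sum_smul_left]
    exact sum_eq_zero fun j _ => by rw [hip (e j) (K ry), hKry j, mul_zero]
  constructor
  · conv_lhs => rw [hx, hy]
    simp only [map_add, LinearMap.add_apply, hpxry, hrxpy, hpxpy, add_zero, zero_add]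
  · conv_lhs => rw [hx, hy]
    simp only [map_add, LinearMap.add_apply, hpxKpy, hrxKpy, hpxKry, add_zero, zero_add]

end Abstract

/-! ## §2 Over the tree's physical subspace; the coupling defect -/

section Femto

variable {L : ℕ} [NeZero L]

/-- **Polarised Pythagorean split against a finite exact physical eigenfamily.** [cite: ReedSimonIV1978, Thm XIII.1] -/
theorem bilin_split_eigenfamily (β : ℝ) {N : ℕ} {ψ : Fin N → (GaugeConfig 3 L SU2 → ℝ)} (hψ : ∀ j, IsPhys (ψ j))
    (hon : ∀ i l, l2 (ψ i) (ψ l) = if i = l then 1 else 0) (ev : Fin N → ℝ)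
    (heig : ∀ j, transferApply β (ψ j) = ev j • ψ j) {u v : GaugeConfig 3 L SU2 → ℝ} (hu : IsPhys u) (hv : IsPhys v) :
    l2 u v = ∑ j, l2 u (ψ j) * l2 v (ψ j) + l2 (u - ∑ j, l2 u (ψ j) • ψ j) (v - ∑ j, l2 v (ψ j) • ψ j) ∧
      l2 u (transferApply β v) = ∑ j, ev j * (l2 u (ψ j) * l2 v (ψ j)) +
        l2 (u - ∑ j, l2 u (ψ j) • ψ j) (transferApply β (v - ∑ j, l2 v (ψ j) • ψ j)) := by
  set e : Fin N → physSubmodule L := fun j => ⟨ψ j, hψ j⟩ with he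
  have hon' : ∀ i l, l2Form L (e i) (e l) = if i = l then 1 else 0 := fun i l => by
    simpa only [l2Form_apply, he, Submodule.coe_mk] using hon i l
  have heig' : ∀ j, transferOp β (e j) = ev j • e j := fun j => by
    apply Subtype.ext
    simpa only [coe_transferOp, Submodule.coe_smul, he, Submodule.coe_mk] using heig j
  have h := bilin_split_abstract (l2Form L) l2Form_symm (transferOp β) (transferOp_symm β) e ev hon' heig' ⟨u, hu⟩ ⟨v, hv⟩
  simpa only [l2Form_apply, coe_transferOp, Submodule.coe_sub, Submodule.coe_sum, Submodule.coe_smul, Submodule.coe_mk, he] using h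

/-- ★ **Coupling defect**: for physical `u, v`, any exact physical eigenfamily, and ANY reference value `κ̄`:
`|⟨u,K_βv⟩ − κ̄⟨u,v⟩| ≤ Σ_j |λ_j − κ̄|·|⟨u,ψ_j⟩⟨v,ψ_j⟩| + (λ₀ + |κ̄|)·‖r_u‖‖r_v‖` (`β ≥ 0`; `‖r‖ = √⟨r,r⟩`). [cite: Kato1949, §1] -/
theorem coupling_defect_le {β : ℝ} (hβ : 0 ≤ β) {N : ℕ} {ψ : Fin N → (GaugeConfig 3 L SU2 → ℝ)} (hψ : ∀ j, IsPhys (ψ j))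
    (hon : ∀ i l, l2 (ψ i) (ψ l) = if i = l then 1 else 0) (ev : Fin N → ℝ)
    (heig : ∀ j, transferApply β (ψ j) = ev j • ψ j) {u v : GaugeConfig 3 L SU2 → ℝ} (hu : IsPhys u) (hv : IsPhys v) (κ : ℝ) :
    |l2 u (transferApply β v) - κ * l2 u v| ≤
      ∑ j, |ev j - κ| * |l2 u (ψ j) * l2 v (ψ j)| +
        (levelValue su2Rep L β 0 + |κ|) *
          (Real.sqrt (l2 (u - ∑ j, l2 u (ψ j) • ψ j) (u - ∑ j, l2 u (ψ j) • ψ j)) *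
            Real.sqrt (l2 (v - ∑ j, l2 v (ψ j) • ψ j) (v - ∑ j, l2 v (ψ j) • ψ j))) := by
  obtain ⟨hn, hd⟩ := bilin_split_eigenfamily β hψ hon ev heig hu hv
  set ru := u - ∑ j, l2 u (ψ j) • ψ j with hru
  set rv := v - ∑ j, l2 v (ψ j) • ψ j with hrv
  have hruP : IsPhys ru := isPhys_remainder hψ hu
  have hrvP : IsPhys rv := isPhys_remainder hψ hv
  have hl0 : 0 ≤ levelValue su2Rep L β 0 := levelValue_su2Rep_nonneg L hβ 0
  -- Cauchy–Schwarz for `l2` and for the `K_β`-form, top bounds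
  have hcs0 : |l2 ru rv| ≤ Real.sqrt (l2 ru ru) * Real.sqrt (l2 rv rv) := by
    rw [← Real.sqrt_mul (l2_self_nonneg _), ← Real.sqrt_sq_eq_abs]
    exact Real.sqrt_le_sqrt (by simpa [sq] using sq_l2_le hruP hrvP)
  have hcsK : |l2 ru (transferApply β rv)| ≤ levelValue su2Rep L β 0 * (Real.sqrt (l2 ru ru) * Real.sqrt (l2 rv rv)) := by
    have h1 : (qform su2Rep β ru rv) ^ 2 ≤ qform su2Rep β ru ru * qform su2Rep β rv rv := sq_qform_le hβ hruP hrvP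
    have h2 : qform su2Rep β ru ru ≤ levelValue su2Rep L β 0 * l2 ru ru := VacDict.qform_self_le_levelValue_zero_mul β hruP
    have h3 : qform su2Rep β rv rv ≤ levelValue su2Rep L β 0 * l2 rv rv := VacDict.qform_self_le_levelValue_zero_mul β hrvP
    have hq0 : 0 ≤ qform su2Rep β ru ru := qform_su2Rep_self_nonneg hβ hruP
    have h4 : (qform su2Rep β ru rv) ^ 2 ≤ (levelValue su2Rep L β 0 * (Real.sqrt (l2 ru ru) * Real.sqrt (l2 rv rv))) ^ 2 := by
      have : (levelValue su2Rep L β 0 * (Real.sqrt (l2 ru ru) * Real.sqrt (l2 rv rv))) ^ 2 =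
          (levelValue su2Rep L β 0 * l2 ru ru) * (levelValue su2Rep L β 0 * l2 rv rv) := by
        rw [mul_pow, mul_pow, Real.sq_sqrt (l2_self_nonneg _), Real.sq_sqrt (l2_self_nonneg _)]; ring
      rw [this]
      exact h1.trans (mul_le_mul h2 h3 (qform_su2Rep_self_nonneg hβ hrvP) (hq0.trans h2))
    rw [qform_eq_l2_transferApply] at h4
    have h5 := abs_le_of_sq_le_sq' h4 (mul_nonneg hl0 (mul_nonneg (Real.sqrt_nonneg _) (Real.sqrt_nonneg _)))
    exact abs_le.mpr ⟨h5.1, h5.2⟩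
  have hs : ∑ j, (ev j - κ) * (l2 u (ψ j) * l2 v (ψ j)) =
      ∑ j, ev j * (l2 u (ψ j) * l2 v (ψ j)) - κ * ∑ j, l2 u (ψ j) * l2 v (ψ j) := by
    rw [Finset.mul_sum, ← Finset.sum_sub_distrib]
    exact Finset.sum_congr rfl fun j _ => by ring
  have hdiff : l2 u (transferApply β v) - κ * l2 u v =
      ∑ j, (ev j - κ) * (l2 u (ψ j) * l2 v (ψ j)) + (l2 ru (transferApply β rv) - κ * l2 ru rv) := by
    rw [hd, hn, hs]; ring
  rw [hdiff]
  have hsum : |∑ j, (ev j - κ) * (l2 u (ψ j) * l2 v (ψ j))| ≤ ∑ j, |ev j - κ| * |l2 u (ψ j) * l2 v (ψ j)| :=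
    (Finset.abs_sum_le_sum_abs _ _).trans (le_of_eq (Finset.sum_congr rfl fun j _ => by rw [abs_mul]))
  have hrest : |l2 ru (transferApply β rv) - κ * l2 ru rv| ≤
      (levelValue su2Rep L β 0 + |κ|) * (Real.sqrt (l2 ru ru) * Real.sqrt (l2 rv rv)) := by
    have h1 : |κ * l2 ru rv| ≤ |κ| * (Real.sqrt (l2 ru ru) * Real.sqrt (l2 rv rv)) := by
      rw [abs_mul]; exact mul_le_mul_of_nonneg_left hcs0 (abs_nonneg _)
    calc |l2 ru (transferApply β rv) - κ * l2 ru rv| ≤ |l2 ru (transferApply β rv)| + |κ * l2 ru rv| := abs_sub _ _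
      _ ≤ levelValue su2Rep L β 0 * (Real.sqrt (l2 ru ru) * Real.sqrt (l2 rv rv)) + |κ| * (Real.sqrt (l2 ru ru) * Real.sqrt (l2 rv rv)) :=
          add_le_add hcsK h1
      _ = (levelValue su2Rep L β 0 + |κ|) * (Real.sqrt (l2 ru ru) * Real.sqrt (l2 rv rv)) := by ring
  exact (abs_add_le _ _).trans (add_le_add hsum hrest)

/-- ★★ **The (o6) conjunct of `PolyakovLift.DynamicCoreClauses k C β u`, VERBATIM, from the slow/stiff coupling budget**: for each pair `i ≠ l` an exact
physical `l2`-orthonormal eigenfamily and the bound `Σ_j |λ_j − κ̄_il|·|⟨u_i,ψ_j⟩⟨u_l,ψ_j⟩| + (λ₀ + |κ̄_il|)‖r_i‖‖r_l‖ ≤ C(λ²/L)λ₀√n_i√n_l` with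
`κ̄_il = ½(d_ii/n_ii + d_ll/n_ll)`. [cite: Luscher1983, §3] [cite: Kato1949, §1] -/
theorem coreO6_of_slow_stiff {k : ℕ} (C : ℝ) {β : ℝ} (hβ : 0 ≤ β) {u : Fin k → (GaugeConfig 3 L SU2 → ℝ)} (hu : ∀ i, IsPhys (u i))
    (h : ∀ i l : Fin k, i ≠ l → ∃ (N : ℕ) (ψ : Fin N → (GaugeConfig 3 L SU2 → ℝ)) (ev : Fin N → ℝ),
      (∀ j, IsPhys (ψ j)) ∧ (∀ j j', l2 (ψ j) (ψ j') = if j = j' then 1 else 0) ∧ (∀ j, transferApply β (ψ j) = ev j • ψ j) ∧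
      ∑ j, |ev j - (l2 (u i) (transferApply β (u i)) / l2 (u i) (u i) + l2 (u l) (transferApply β (u l)) / l2 (u l) (u l)) / 2| *
            |l2 (u i) (ψ j) * l2 (u l) (ψ j)| +
          (levelValue su2Rep L β 0 +
              |(l2 (u i) (transferApply β (u i)) / l2 (u i) (u i) + l2 (u l) (transferApply β (u l)) / l2 (u l) (u l)) / 2|) *
            (Real.sqrt (l2 (u i - ∑ j, l2 (u i) (ψ j) • ψ j) (u i - ∑ j, l2 (u i) (ψ j) • ψ j)) *
              Real.sqrt (l2 (u l - ∑ j, l2 (u l) (ψ j) • ψ j) (u l - ∑ j, l2 (u l) (ψ j) • ψ j))) ≤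
        C * (luscherLambda β L ^ 2 / L) * levelValue su2Rep L β 0 * (Real.sqrt (l2 (u i) (u i)) * Real.sqrt (l2 (u l) (u l)))) :
    ∀ i l : Fin k, i ≠ l →
      |l2 (u i) (transferApply β (u l)) -
          (l2 (u i) (transferApply β (u i)) / l2 (u i) (u i) + l2 (u l) (transferApply β (u l)) / l2 (u l) (u l)) / 2 *
            l2 (u i) (u l)|
        ≤ C * (luscherLambda β L ^ 2 / L) * levelValue su2Rep L β 0 * (Real.sqrt (l2 (u i) (u i)) * Real.sqrt (l2 (u l) (u l))) := by
  intro i l hil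
  obtain ⟨N, ψ, ev, hψ, hon, heig, hbudget⟩ := h i l hil
  exact (coupling_defect_le hβ hψ hon ev heig (hu i) (hu l) _).trans hbudget

end Femto

end Summit.QuantumFields.YangMills.Theorems.FemtoTransferGap.LiftPos

end
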